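/-
Copyright (c) 2026 the pub-hodgecm-mathlib formalisation cell (harness21).  Prover seat hodgecm-mathlib-K2Liu-p09 (g8), Track B «K2-LIT» ∕ hLiu418
#184♮, Road I v3, unit U5 «THE CLOSE»: the `hT₁ hT₂` LEVI-COVARIANCE row of the #42F′ face — ONE coefficient-transport lemma for every continuous,
left-`H(L⁺)`-invariant form (LEAD F0P6-plan (g14) BATCH #98 (3)).  THEOREMS ONLY.  2026-09-04.
-/
import Summits.HodgeConjecture.HodgeConjecture.Theorems.K2LiuFourierCoeffDeltaContinuous     -- ★ `exists_bound_mul_of_unipDeltaRat_invariant` (+ ★ Φ1 weight independence)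
import Summits.HodgeConjecture.HodgeConjecture.Theorems.K2LiuUnipDeltaConjMeasurePreserving   -- ★ `measurePreserving_conj`, `lintegral_comp_eq_of_isCoveringWeight` (+ `exists_conj_mulEquiv`, `isCoveringWeight_comp`)
import Summits.HodgeConjecture.HodgeConjecture.Theorems.K2LiuSiegelLeviConjUnipDeltaChar      -- ★ Φ2: `unipDeltaChar_conj_eq`, `conj_mem_unipDelta`, `exists_rat_levi_blocks`
import HarnessLib

/-!
# K2_Liu road (hLiu418 = stmt-HodgeConjecture-24832), Road I v3, unit U5: LEVI TRANSPORT OF THE UNIPOTENT FOURIER COEFFICIENTS —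
# `φ_S(p⁻¹·h) = φ_{D₀ S A₀⁻¹}(h)` for a rational Siegel element `p` with Levi blocks `(A₀, D₀)` and ANY continuous left-`H(L⁺)`-invariant `φ`

Cell `pub/hodgecm-mathlib` (D-0151), Track B, build stream 29; helper lane, count-neutral.  The #42F′ face (FACE-D′ ★ p862586 ED. 6 :113–119; FACE-L″) asks, for
BOTH linear maps `T₁` (residue side) and `T₂` (theta side), for the automorphy of their hermitian Fourier coefficients under the rational Levi:
`coeff ((γ^σ)ᵀ β γ) ∘ T_i = R γ ∘ (coeff β ∘ T_i) ∘ S γ` with `R γ :=` left-translation by the rational Levi element and `S γ := id` (desk K2E5-r02 (g6)'s reading).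
Both rows follow from ONE statement about the coefficient functionals ★ Φ1 `fourierCoeffDelta νN β S φ h = (∫β)⁻¹ • ∫ β(u) • (conj ψ_S(u) · φ(u h)) dνN(u)`,
valid for EVERY continuous, left-`H(L⁺)`-invariant `φ : H(𝔸) → ℂ` — which `T₁ x` is by ★ U5-0c clause (c) and `T₂ x` is by ★ p862640
`K2LiuLineThetaFunctionalOfRecord.continuous_thetaFunctional ∕ thetaFunctional_ratH_mul`:

* **`fourierCoeffDelta_rat_siegel_inv_mul`** — for `p ∈ P_Δ(𝔸) ∩ H(L⁺)` with rational Levi blocks `a = A₀ ⊗ 1` (`= deltaBlock p`) and `d = D₀ ⊗ 1` (the `(2,2)`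
  frame block) — ★ `exists_rat_levi_blocks` supplies them for every rational Siegel `p` —, a Haar measure `νN` on `N_Δ(𝔸)`, an `N_Δ(L⁺)`-covering weight `β` of
  finite mass, and `φ` continuous and left-`H(L⁺)`-invariant:  `φ_S(p⁻¹ · h) = φ_{D₀ S A₀⁻¹}(h)` for every index `S ∈ M_n(L)` and every `h ∈ H(𝔸)`.
  PROOF (Tan §3 ∕ Mœglin–Waldspurger I.2.6, three ★ bricks): `φ(u p⁻¹ h) = φ(p⁻¹ · (p u p⁻¹) h) = φ((p u p⁻¹) h)` (left-invariance under the rational `p⁻¹`);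
  the substitution `v = p u p⁻¹` preserves `νN` (★ `measurePreserving_conj`: a rational element normalising `N_Δ` preserves every Haar measure of `N_Δ(𝔸)`),
  carries `ψ_S(u) = ψ_S(p⁻¹ v p) = ψ_{D₀ S A₀⁻¹}(v)` (★ Φ2 `unipDeltaChar_conj_eq`) and the weight to `β′ = β(p⁻¹ · p)`, again an `N_Δ(L⁺)`-covering weight of the
  same mass (★ `isCoveringWeight_comp`, ★ `lintegral_comp_eq_of_isCoveringWeight`); finally the coefficient does not depend on the covering weight (★ Φ1 (A2)
  `fourierCoeffDelta_eq_of_isCoveringWeight`; boundedness of `u ↦ φ(u h)` from ★ `exists_bound_mul_of_unipDeltaRat_invariant`).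
* `fourierCoeffDelta_rat_siegel_mul` — the same read at `p · h`: `φ_{D₀ S A₀⁻¹}(p · h) = φ_S(h)`.
* §3 **`coeffTransport_apply`** (+ `exists_blocks_coeffTransport`) — the FACE-row shape: for ANY map `T : D → (H(𝔸) → ℂ)` with continuous, left-`H(L⁺)`-invariant values (both `T₁` and `T₂`),
  `fourierCoeffDelta νN β (D₀ S A₀⁻¹) (T x) = (fourierCoeffDelta νN β S (T x)) ∘ (p⁻¹ · )` — the coefficient at the Levi-moved index IS the left-translate of the
  coefficient, uniformly in `x`; the payer's dictionary `coeff β := cf (T_L⁻¹ β)` (★ (c) `exists_linear_fourierCoeffDelta`) and the unitarity relation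
  `σ(A₀)ᵀ T_L D₀ = T_L` (★ `exists_rat_levi_blocks`, last clause) turn `β ↦ (γ^σ)ᵀ β γ` into `S ↦ D₀ S A₀⁻¹`.

No definition, no instance, no notation, no named-fact hypothesis, no `sorry`; axioms ⊆ {propext, Classical.choice, Quot.sound}.  HONEST LABEL: HC_CM is proved only
modulo the 7 printed citations (2 remaining named inputs: hLiu418 = stmt-HodgeConjecture-24832, h413 = stmt-HodgeConjecture-24833) until rung 0 closes; this file is a
`--supports stmt-HodgeConjecture-24832` helper and moves no counter.

References: [Tan1999] V. Tan, Canad. J. Math. 51 (1999) §3 (Fourier coefficients along the Siegel unipotent, Levi action on the indices); [MoeglinWaldspurger1995]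
C. Mœglin, J.-L. Waldspurger, Cambridge Tracts 113 (1995) I.2.6, II.1.7; [Shimura1997] G. Shimura, Euler Products and Eisenstein Series, §18.1 (18.4)–(18.5);
[KudlaRallis1994] S. Kudla, S. Rallis, Ann. of Math. 140 (1994) §2; [HarrisKudlaSweet1996] §1 (1.11)–(1.12).
-/

set_option autoImplicit false
set_option linter.dupNamespace false

noncomputable section

open scoped Matrix ENNReal NNReal ComplexConjugate
open NumberField IsDedekindDomain MeasureTheory MeasureTheory.Measure Filter Set Function
open Literature.NumberTheory.Automorphic Literature.NumberTheory.Automorphic.UnitaryGroup Literature.NumberTheory.GaloisRepresentations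
open Literature.NumberTheory.GelbartRogawski1991 Literature.NumberTheory.GelbartRogawski1991.GRConstruction
open Literature.NumberTheory.K2Lit.SiegelDoubled Literature.MeasureTheory.Group

namespace Summit.HodgeConjecture.HodgeConjecture.Cruxes.HLiu418.K2LiuFourierCoeffDeltaLeviTransport

open K2LiuSiegelUnipotentFourierDefs K2LiuSiegelUnipotentCharacters K2LiuUnipotentCoveringWeight
open K2LiuSiegelFourierCoeffDelta (fourierCoeffDelta_eq_of_isCoveringWeight)
open K2LiuFourierCoeffDeltaContinuous (exists_bound_mul_of_unipDeltaRat_invariant)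
open K2LiuUnipDeltaConjMeasurePreserving (measurePreserving_conj lintegral_comp_eq_of_isCoveringWeight)
open K2LiuConstantTermMiddleCellPrelims (exists_conj_mulEquiv)
open K2LiuCoveringWeightTransport (isCoveringWeight_comp)
open K2LiuSiegelLeviConjUnipDeltaChar (unipDeltaChar_conj_eq conj_mem_unipDelta)

variable (L : Type) [Field L] [NumberField L] [IsCMField L]
variable {N M n : ℕ} (e : Fin N × Fin M ≃ Fin n)
  (dV : Fin N → L) (hdV : ∀ i, IsCMField.complexConj L (dV i) = dV i)
  (dW : Fin M → L) (hdW : ∀ i, IsCMField.complexConj L (dW i) = dW i)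
variable [MeasurableSpace (unipDelta L e dV hdV dW hdW)] [BorelSpace (unipDelta L e dV hdV dW hdW)]

/-! ## §1 The integrand after conjugation: pointwise bookkeeping -/

omit [MeasurableSpace (unipDelta L e dV hdV dW hdW)] [BorelSpace (unipDelta L e dV hdV dW hdW)] in
/-- **`u · (p⁻¹ h) = p⁻¹ · ((p u p⁻¹) · h)`** in `H(𝔸)`. [cite: MoeglinWaldspurger1995, I.2.6] -/
theorem mul_inv_mul_eq (p u h : HA L e dV hdV dW hdW) : u * (p⁻¹ * h) = p⁻¹ * (p * u * p⁻¹ * h) := by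
  simp only [mul_assoc, inv_mul_cancel_left]

/-! ## §2 Levi transport of the coefficients -/

/-- **LEVI TRANSPORT OF THE UNIPOTENT FOURIER COEFFICIENTS.**  Let `p ∈ P_Δ(𝔸) ∩ H(L⁺)` have rational Levi blocks `deltaBlock p = A₀ ⊗ 1`, `(2,2)`-frame block
`D₀ ⊗ 1` (★ `exists_rat_levi_blocks`), `νN` a Haar measure on `N_Δ(𝔸)`, `β` an `N_Δ(L⁺)`-covering weight of finite mass, and `φ : H(𝔸) → ℂ` continuous and
left-`H(L⁺)`-invariant.  Then for every index `S` and every `h`:  `φ_S(p⁻¹ · h) = φ_{D₀ S A₀⁻¹}(h)`.  (Substitution `v = p u p⁻¹` — ★ `measurePreserving_conj` —,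
★ `unipDeltaChar_conj_eq`, and ★ weight independence.) [cite: Tan1999, §3] [cite: MoeglinWaldspurger1995, I.2.6] [cite: Shimura1997, §18.1 (18.4)–(18.5)] -/
theorem fourierCoeffDelta_rat_siegel_inv_mul (hdV0 : ∀ i, dV i ≠ 0) (hdW0 : ∀ i, dW i ≠ 0)
    (νN : Measure (unipDelta L e dV hdV dW hdW)) [νN.IsHaarMeasure]
    {β : unipDelta L e dV hdV dW hdW → ℝ≥0∞} (hβ : IsCoveringWeight (unipDeltaRat L e dV hdV dW hdW) β) (hβtop : ∫⁻ u, β u ∂νN ≠ ∞)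
    {p : HA L e dV hdV dW hdW} (hpS : IsSiegelDelta L e dV hdV dW hdW p) (hpr : p ∈ ratH L e dV hdV dW hdW)
    {A₀ D₀ : Matrix (Fin n) (Fin n) L} (hA₀ : IsUnit A₀.det)
    (ha : deltaBlock L e dV hdV dW hdW p = A₀.map (algebraMap L (AdeleRing (𝓞 L) L)))
    (hd : (Matrix.fromBlocks (1 : Matrix (Fin n) (Fin n) (AdeleRing (𝓞 L) L)) 0 (-1) 1 * blk L e dV hdV dW hdW p * Matrix.fromBlocks 1 0 1 1).toBlocks₂₂ =
      D₀.map (algebraMap L (AdeleRing (𝓞 L) L)))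
    (S : Matrix (Fin n) (Fin n) L) {φ : HA L e dV hdV dW hdW → ℂ} (hφc : Continuous φ)
    (hφγ : ∀ (γ : ratH L e dV hdV dW hdW) (x : HA L e dV hdV dW hdW), φ ((γ : HA L e dV hdV dW hdW) * x) = φ x)
    (h : HA L e dV hdV dW hdW) :
    fourierCoeffDelta L e dV hdV dW hdW νN β S φ (p⁻¹ * h) = fourierCoeffDelta L e dV hdV dW hdW νN β (D₀ * S * A₀⁻¹) φ h := by
  -- `p` and `p⁻¹` normalise `N_Δ(𝔸)`
  have hp : ∀ u : HA L e dV hdV dW hdW, u ∈ unipDelta L e dV hdV dW hdW → p * u * p⁻¹ ∈ unipDelta L e dV hdV dW hdW := fun u hu => by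
    have h' := conj_mem_unipDelta L e dV hdV dW hdW (isSiegelDelta_inv L e dV hdV dW hdW hpS) hu
    rwa [inv_inv] at h'
  have hp' : ∀ u : HA L e dV hdV dW hdW, u ∈ unipDelta L e dV hdV dW hdW → p⁻¹ * u * p ∈ unipDelta L e dV hdV dW hdW := fun u hu =>
    conj_mem_unipDelta L e dV hdV dW hdW hpS hu
  -- the conjugation automorphism `Φ : u ↦ p u p⁻¹` of `N_Δ(𝔸)` and its measure-theoretic properties
  obtain ⟨Φ, hΦ, hΦs⟩ := exists_conj_mulEquiv p hp hp'
  have hΦfun : (Φ : unipDelta L e dV hdV dW hdW → unipDelta L e dV hdV dW hdW) =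
      fun u : unipDelta L e dV hdV dW hdW => (⟨p * (u : HA L e dV hdV dW hdW) * p⁻¹, hp _ u.2⟩ : unipDelta L e dV hdV dW hdW) :=
    funext fun u => Subtype.ext (hΦ u)
  have hΦsfun : (Φ.symm : unipDelta L e dV hdV dW hdW → unipDelta L e dV hdV dW hdW) =
      fun u : unipDelta L e dV hdV dW hdW => (⟨p⁻¹ * (u : HA L e dV hdV dW hdW) * p, hp' _ u.2⟩ : unipDelta L e dV hdV dW hdW) :=
    funext fun u => Subtype.ext (hΦs u)
  have hΦc : Continuous (Φ : unipDelta L e dV hdV dW hdW → unipDelta L e dV hdV dW hdW) := by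
    rw [hΦfun]; exact Continuous.subtype_mk ((continuous_const.mul continuous_subtype_val).mul continuous_const) _
  have hΦsc : Continuous (Φ.symm : unipDelta L e dV hdV dW hdW → unipDelta L e dV hdV dW hdW) := by
    rw [hΦsfun]; exact Continuous.subtype_mk ((continuous_const.mul continuous_subtype_val).mul continuous_const) _
  have hΦsm : Measurable (Φ.symm : unipDelta L e dV hdV dW hdW → unipDelta L e dV hdV dW hdW) := hΦsc.measurable
  let Ψ : unipDelta L e dV hdV dW hdW ≃ₜ unipDelta L e dV hdV dW hdW :=
    { toEquiv := Φ.toEquiv, continuous_toFun := hΦc, continuous_invFun := hΦsc }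
  have hme : MeasurableEmbedding (Φ : unipDelta L e dV hdV dW hdW → unipDelta L e dV hdV dW hdW) := Ψ.measurableEmbedding
  have hmp : MeasurePreserving (Φ : unipDelta L e dV hdV dW hdW → unipDelta L e dV hdV dW hdW) νN νN := by
    rw [hΦfun]; exact measurePreserving_conj hdV0 hdW0 νN hpr hp hp'
  -- `Φ.symm` preserves the lattice `N_Δ(L⁺)`
  have hΦsΓ : (unipDeltaRat L e dV hdV dW hdW).comap Φ.symm.toMonoidHom = unipDeltaRat L e dV hdV dW hdW := by
    ext u
    rw [Subgroup.mem_comap, MulEquiv.coe_toMonoidHom, mem_unipDeltaRat_iff, mem_unipDeltaRat_iff, hΦs u]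
    refine ⟨fun h0 => ?_, fun h0 => mul_mem (mul_mem (inv_mem hpr) h0) hpr⟩
    have h' := mul_mem (mul_mem hpr h0) (inv_mem hpr)
    rwa [← mul_assoc, ← mul_assoc, mul_inv_cancel, one_mul, mul_assoc, mul_inv_cancel, mul_one] at h'
  -- the transported weight `β′ = β(p⁻¹ · p)`: covering, same mass
  have hβ' : IsCoveringWeight (unipDeltaRat L e dV hdV dW hdW) (fun v => β (Φ.symm v)) := by
    have h0 := isCoveringWeight_comp Φ.symm hΦsm (unipDeltaRat L e dV hdV dW hdW) hβ
    rwa [hΦsΓ] at h0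
  have hmass : ∫⁻ v, β (Φ.symm v) ∂νN = ∫⁻ u, β u ∂νN := lintegral_comp_eq_of_isCoveringWeight νN Φ.symm hΦsm hΦsΓ hβ
  -- the hypotheses of weight independence for `φ` at `h`
  have hφch : Continuous fun u : unipDelta L e dV hdV dW hdW => φ ((u : HA L e dV hdV dW hdW) * h) :=
    hφc.comp (continuous_subtype_val.mul continuous_const)
  have hφN : ∀ (γ : unipDeltaRat L e dV hdV dW hdW) (x : HA L e dV hdV dW hdW),
      φ (((γ : unipDelta L e dV hdV dW hdW) : HA L e dV hdV dW hdW) * x) = φ x := fun γ x =>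
    hφγ ⟨_, (mem_unipDeltaRat_iff L e dV hdV dW hdW _).1 γ.2⟩ x
  have hφNh : ∀ (γ : unipDeltaRat L e dV hdV dW hdW) (u : unipDelta L e dV hdV dW hdW),
      φ ((((γ : unipDelta L e dV hdV dW hdW) * u : unipDelta L e dV hdV dW hdW) : HA L e dV hdV dW hdW) * h) = φ ((u : HA L e dV hdV dW hdW) * h) :=
    fun γ u => by rw [Subgroup.coe_mul, mul_assoc, hφN]
  have hφb := exists_bound_mul_of_unipDeltaRat_invariant L e dV hdV dW hdW hdV0 hdW0 hφc hφN h
  -- the integrand of `φ_S(p⁻¹ h)` at `u` is the integrand of `φ′_{S′}(h)` at `v = Φ u`, `S′ = D₀ S A₀⁻¹`, weight `β′`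
  set G : unipDelta L e dV hdV dW hdW → ℂ := fun v =>
    (β (Φ.symm v)).toReal • (conj (unipDeltaChar L e dV hdV dW hdW (D₀ * S * A₀⁻¹) (v : HA L e dV hdV dW hdW) : ℂ) * φ ((v : HA L e dV hdV dW hdW) * h)) with hG
  have hpt : ∀ u : unipDelta L e dV hdV dW hdW,
      (β u).toReal • (conj (unipDeltaChar L e dV hdV dW hdW S (u : HA L e dV hdV dW hdW) : ℂ) * φ ((u : HA L e dV hdV dW hdW) * (p⁻¹ * h))) = G (Φ u) := by
    intro u
    -- `u = p⁻¹ (Φ u) p`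
    have hu : (u : HA L e dV hdV dW hdW) = p⁻¹ * ((Φ u : unipDelta L e dV hdV dW hdW) : HA L e dV hdV dW hdW) * p := by
      rw [hΦ u]; simp only [mul_assoc, inv_mul_cancel_left, inv_mul_cancel, mul_one]
    have hψ : unipDeltaChar L e dV hdV dW hdW S (u : HA L e dV hdV dW hdW) =
        unipDeltaChar L e dV hdV dW hdW (D₀ * S * A₀⁻¹) ((Φ u : unipDelta L e dV hdV dW hdW) : HA L e dV hdV dW hdW) := by
      rw [hu]
      exact unipDeltaChar_conj_eq L e dV hdV dW hdW hpS hA₀ ha hd S (Φ u).2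
    have hφv : φ ((u : HA L e dV hdV dW hdW) * (p⁻¹ * h)) = φ (((Φ u : unipDelta L e dV hdV dW hdW) : HA L e dV hdV dW hdW) * h) := by
      rw [mul_inv_mul_eq, ← hΦ u, hφγ ⟨p⁻¹, inv_mem hpr⟩]
    simp only [hG, MulEquiv.symm_apply_apply]
    rw [hψ, hφv]
  -- assemble
  rw [fourierCoeffDelta_def, fourierCoeffDelta_def]
  simp_rw [hpt]
  rw [hmp.integral_comp hme G]
  -- the right-hand side is `φ′_{S′}(h)` for the weight `β′` (same mass); switch the weight back to `β`
  have key := fourierCoeffDelta_eq_of_isCoveringWeight L e dV hdV dW hdW νN hβ' hβ (by rw [hmass]; exact hβtop) (D₀ * S * A₀⁻¹) hφch hφb hφNh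
  rw [fourierCoeffDelta_def, fourierCoeffDelta_def, hmass] at key
  simp only [hG]
  exact key

/-- **… read at `p · h`**: `φ_{D₀ S A₀⁻¹}(p · h) = φ_S(h)` (the coefficient at the Levi-moved index is the left-translate of the coefficient).
[cite: Tan1999, §3] [cite: MoeglinWaldspurger1995, I.2.6] -/
theorem fourierCoeffDelta_rat_siegel_mul (hdV0 : ∀ i, dV i ≠ 0) (hdW0 : ∀ i, dW i ≠ 0)
    (νN : Measure (unipDelta L e dV hdV dW hdW)) [νN.IsHaarMeasure]
    {β : unipDelta L e dV hdV dW hdW → ℝ≥0∞} (hβ : IsCoveringWeight (unipDeltaRat L e dV hdV dW hdW) β) (hβtop : ∫⁻ u, β u ∂νN ≠ ∞)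
    {p : HA L e dV hdV dW hdW} (hpS : IsSiegelDelta L e dV hdV dW hdW p) (hpr : p ∈ ratH L e dV hdV dW hdW)
    {A₀ D₀ : Matrix (Fin n) (Fin n) L} (hA₀ : IsUnit A₀.det)
    (ha : deltaBlock L e dV hdV dW hdW p = A₀.map (algebraMap L (AdeleRing (𝓞 L) L)))
    (hd : (Matrix.fromBlocks (1 : Matrix (Fin n) (Fin n) (AdeleRing (𝓞 L) L)) 0 (-1) 1 * blk L e dV hdV dW hdW p * Matrix.fromBlocks 1 0 1 1).toBlocks₂₂ =
      D₀.map (algebraMap L (AdeleRing (𝓞 L) L)))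
    (S : Matrix (Fin n) (Fin n) L) {φ : HA L e dV hdV dW hdW → ℂ} (hφc : Continuous φ)
    (hφγ : ∀ (γ : ratH L e dV hdV dW hdW) (x : HA L e dV hdV dW hdW), φ ((γ : HA L e dV hdV dW hdW) * x) = φ x)
    (h : HA L e dV hdV dW hdW) :
    fourierCoeffDelta L e dV hdV dW hdW νN β (D₀ * S * A₀⁻¹) φ (p * h) = fourierCoeffDelta L e dV hdV dW hdW νN β S φ h := by
  rw [← fourierCoeffDelta_rat_siegel_inv_mul L e dV hdV dW hdW hdV0 hdW0 νN hβ hβtop hpS hpr hA₀ ha hd S hφc hφγ (p * h), inv_mul_cancel_left]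

/-! ## §3 The face-row shape: uniformly in `x`, for any map with continuous left-invariant values -/

/-- **THE `hT₁`∕`hT₂` SHAPE.**  For ANY map `T : D → (H(𝔸) → ℂ)` whose values are continuous and left-`H(L⁺)`-invariant (the residue map ★ U5-0c (c); the line theta
functional ★ `K2LiuLineThetaFunctionalOfRecord`), the coefficient at the Levi-moved index is the LEFT TRANSLATE of the coefficient, uniformly in `x`:
`(T x)_{D₀ S A₀⁻¹} = (T x)_S ∘ (p⁻¹ · )` as functions on `H(𝔸)` — i.e. `coeff (D₀ S A₀⁻¹) ∘ T = R_p ∘ (coeff S ∘ T)` with `R_p G := G ∘ (p⁻¹ · )` and `S γ := id`.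
[cite: Tan1999, §3] [cite: MoeglinWaldspurger1995, I.2.6, II.1.7] -/
theorem coeffTransport_apply (hdV0 : ∀ i, dV i ≠ 0) (hdW0 : ∀ i, dW i ≠ 0)
    (νN : Measure (unipDelta L e dV hdV dW hdW)) [νN.IsHaarMeasure]
    {β : unipDelta L e dV hdV dW hdW → ℝ≥0∞} (hβ : IsCoveringWeight (unipDeltaRat L e dV hdV dW hdW) β) (hβtop : ∫⁻ u, β u ∂νN ≠ ∞)
    {p : HA L e dV hdV dW hdW} (hpS : IsSiegelDelta L e dV hdV dW hdW p) (hpr : p ∈ ratH L e dV hdV dW hdW)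
    {A₀ D₀ : Matrix (Fin n) (Fin n) L} (hA₀ : IsUnit A₀.det)
    (ha : deltaBlock L e dV hdV dW hdW p = A₀.map (algebraMap L (AdeleRing (𝓞 L) L)))
    (hd : (Matrix.fromBlocks (1 : Matrix (Fin n) (Fin n) (AdeleRing (𝓞 L) L)) 0 (-1) 1 * blk L e dV hdV dW hdW p * Matrix.fromBlocks 1 0 1 1).toBlocks₂₂ =
      D₀.map (algebraMap L (AdeleRing (𝓞 L) L)))
    (S : Matrix (Fin n) (Fin n) L) {D : Type*} (T : D → HA L e dV hdV dW hdW → ℂ) (hTc : ∀ x, Continuous (T x))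
    (hTγ : ∀ x (γ : ratH L e dV hdV dW hdW) (h : HA L e dV hdV dW hdW), T x ((γ : HA L e dV hdV dW hdW) * h) = T x h) (x : D) :
    fourierCoeffDelta L e dV hdV dW hdW νN β (D₀ * S * A₀⁻¹) (T x) =
      fun h => fourierCoeffDelta L e dV hdV dW hdW νN β S (T x) (p⁻¹ * h) :=
  funext fun h => (fourierCoeffDelta_rat_siegel_inv_mul L e dV hdV dW hdW hdV0 hdW0 νN hβ hβtop hpS hpr hA₀ ha hd S (hTc x) (hTγ x) h).symm

/-- **… EXISTENTIAL BLOCKS**: for every rational Siegel `p` there ARE rational blocks `(A₀, D₀)` (★ `exists_rat_levi_blocks`, with the unitarity relation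
`σ(A₀)ᵀ T_L D₀ = T_L` that matches the face's hermitian index law `β ↦ (γ^σ)ᵀ β γ` to `S ↦ D₀ S A₀⁻¹` under the payer's dictionary) for which the transport holds.
[cite: Tan1999, §3] [cite: HarrisKudlaSweet1996, §1 (1.11)–(1.12)] -/
theorem exists_blocks_coeffTransport (hdV0 : ∀ i, dV i ≠ 0) (hdW0 : ∀ i, dW i ≠ 0)
    (νN : Measure (unipDelta L e dV hdV dW hdW)) [νN.IsHaarMeasure]
    {β : unipDelta L e dV hdV dW hdW → ℝ≥0∞} (hβ : IsCoveringWeight (unipDeltaRat L e dV hdV dW hdW) β) (hβtop : ∫⁻ u, β u ∂νN ≠ ∞)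
    {p : HA L e dV hdV dW hdW} (hpS : IsSiegelDelta L e dV hdV dW hdW p) (hpr : p ∈ ratH L e dV hdV dW hdW)
    {φ : HA L e dV hdV dW hdW → ℂ} (hφc : Continuous φ)
    (hφγ : ∀ (γ : ratH L e dV hdV dW hdW) (x : HA L e dV hdV dW hdW), φ ((γ : HA L e dV hdV dW hdW) * x) = φ x) :
    ∃ A₀ D₀ : Matrix (Fin n) (Fin n) L, IsUnit A₀.det ∧
      deltaBlock L e dV hdV dW hdW p = A₀.map (algebraMap L (AdeleRing (𝓞 L) L)) ∧
      (A₀.map ((IsCMField.complexConj L : L ≃ₐ[Fp L] L) : L →+* L))ᵀ * (gramR L e dV hdV dW hdW).map (algebraMap (Fp L) L) * D₀ =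
        (gramR L e dV hdV dW hdW).map (algebraMap (Fp L) L) ∧
      ∀ (S : Matrix (Fin n) (Fin n) L) (h : HA L e dV hdV dW hdW),
        fourierCoeffDelta L e dV hdV dW hdW νN β S φ (p⁻¹ * h) = fourierCoeffDelta L e dV hdV dW hdW νN β (D₀ * S * A₀⁻¹) φ h := by
  obtain ⟨A₀, D₀, hA₀, ha, hd, hrel⟩ := K2LiuSiegelLeviConjUnipDeltaChar.exists_rat_levi_blocks L e dV hdV dW hdW hdV0 hdW0 hpS hpr
  exact ⟨A₀, D₀, hA₀, ha, hrel, fun S h =>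
    fourierCoeffDelta_rat_siegel_inv_mul L e dV hdV dW hdW hdV0 hdW0 νN hβ hβtop hpS hpr hA₀ ha hd S hφc hφγ h⟩

end Summit.HodgeConjecture.HodgeConjecture.Cruxes.HLiu418.K2LiuFourierCoeffDeltaLeviTransport

end
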